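import Mathlib
import Summits.Ventures.DiscreteObjects.Mahler.SmythTheorem

/-!
# `M(p(x^k)) = M(p)` and the sharpness of Smyth's bound (venture `DiscreteObjects`, target L)

Cell `pub-namedobj`, seat `pub-namedobj-mahler` (gen 8). Framing: lottery ticket; floor = certified
bounds/negative ranges.

* `mahlerMeasure_X_pow_sub_C` — `M(x^k - a) = max(1, ‖a‖)` (`k ≥ 1`);
* `mahlerMeasure_comp_X_pow`, `intMahlerMeasure_comp_X_pow` — `M(p(x^k)) = M(p)` for every `k ≥ 1`
  (generalises gen 3's `mahlerMeasure_comp_X_pow_two`); this is the invariance behind "primitive"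
  polynomials in [MossinghoffRhinWu2008, Thm 1.1] and behind the Lehmer lifts `L(±x^j)` expected as
  survivors of the height-1 census;
* `smyth_bound_attained` — Smyth's bound `M(P) ≥ θ₀` for nonreciprocal `P`
  (`SmythTheorem.intMahlerMeasure_ge_smythTheta_of_nonreciprocal`) is SHARP: `x³ - x - 1` is
  nonreciprocal with `M = θ₀`; more generally every `x^{3k} - x^k - 1` attains it
  (`intMahlerMeasure_X_pow_three_mul_sub`), as in the equality statement of [McKee–Smyth, Thm 12.1].
-/

namespace Summit.Ventures.DiscreteObjects.Mahler

open Polynomial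

/-- For `t ≥ 0` and any `k`: `(max 1 t)^k = max 1 (t^k)`. -/
theorem max_one_pow {t : ℝ} (ht : 0 ≤ t) (k : ℕ) : (max 1 t) ^ k = max 1 (t ^ k) := by
  rcases le_total t 1 with h | h
  · rw [max_eq_left h, one_pow, max_eq_left (pow_le_one₀ ht h)]
  · rw [max_eq_right h, max_eq_right (one_le_pow₀ h)]

/-- `M(x^k - a) = max(1, ‖a‖)` for `k ≥ 1`: the roots are the `k`-th roots of `a`. -/
theorem mahlerMeasure_X_pow_sub_C {k : ℕ} (hk : 1 ≤ k) (a : ℂ) :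
    (X ^ k - C a : ℂ[X]).mahlerMeasure = max 1 ‖a‖ := by
  have hk0 : k ≠ 0 := by omega
  have hmonic : (X ^ k - C a : ℂ[X]).Monic := monic_X_pow_sub_C a hk0
  rw [mahlerMeasure_eq_leadingCoeff_mul_prod_roots, hmonic.leadingCoeff, norm_one, one_mul]
  have hroots : ∀ β ∈ (X ^ k - C a : ℂ[X]).roots, max 1 ‖β‖ = max 1 (‖a‖ ^ ((1 : ℝ) / k)) := by
    intro β hβ
    have hβk : β ^ k = a := by
      have := (mem_roots hmonic.ne_zero).mp hβ
      rw [IsRoot, eval_sub, eval_pow, eval_X, eval_C, sub_eq_zero] at this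
      exact this
    congr 1
    have h1 : ‖β‖ ^ k = ‖a‖ := by rw [← norm_pow, hβk]
    rw [← h1, ← Real.rpow_natCast, ← Real.rpow_mul (norm_nonneg β)]
    rw [mul_one_div_cancel (by exact_mod_cast hk0), Real.rpow_one]
  have hcard : Multiset.card (X ^ k - C a : ℂ[X]).roots = k := by
    have hs := (IsAlgClosed.splits (X ^ k - C a : ℂ[X])).natDegree_eq_card_roots
    rw [natDegree_X_pow_sub_C] at hs
    exact hs.symm
  rw [Multiset.map_congr rfl hroots, Multiset.map_const', Multiset.prod_replicate, hcard,
    max_one_pow (by positivity), ← Real.rpow_natCast, ← Real.rpow_mul (norm_nonneg a),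
    one_div_mul_cancel (by exact_mod_cast hk0), Real.rpow_one]

/-- **`M(p(x^k)) = M(p)`** for every complex polynomial `p` and `k ≥ 1`. -/
theorem mahlerMeasure_comp_X_pow (p : ℂ[X]) {k : ℕ} (hk : 1 ≤ k) :
    (p.comp (X ^ k)).mahlerMeasure = p.mahlerMeasure := by
  have hs := (IsAlgClosed.splits p).eq_prod_roots
  have h1 : (p.comp (X ^ k)).mahlerMeasure =
      ‖p.leadingCoeff‖ * (p.roots.map (fun a ↦ max 1 ‖a‖)).prod := by
    conv_lhs => rw [hs]
    rw [mul_comp, C_comp, multiset_prod_comp, mahlerMeasure_mul, mahlerMeasure_const,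
      prod_mahlerMeasure_eq_mahlerMeasure_prod, Multiset.map_map, Multiset.map_map]
    congr 1
    apply congrArg
    apply Multiset.map_congr rfl
    intro a _
    simp only [Function.comp_apply, sub_comp, X_comp, C_comp]
    exact mahlerMeasure_X_pow_sub_C hk a
  rw [h1, mahlerMeasure_eq_leadingCoeff_mul_prod_roots]

/-- `M(q(x^k)) = M(q)` for integer polynomials and `k ≥ 1`. -/
theorem intMahlerMeasure_comp_X_pow (q : ℤ[X]) {k : ℕ} (hk : 1 ≤ k) :
    intMahlerMeasure (q.comp (X ^ k)) = intMahlerMeasure q := by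
  unfold intMahlerMeasure
  rw [map_comp]
  simp only [Polynomial.map_pow, map_X]
  exact mahlerMeasure_comp_X_pow _ hk

/-! ### Sharpness of Smyth's bound -/

/-- `M(x^{3k} - x^k - 1) = θ₀` for every `k ≥ 1`. -/
theorem intMahlerMeasure_X_pow_three_mul_sub {k : ℕ} (hk : 1 ≤ k) :
    intMahlerMeasure (X ^ (3 * k) - X ^ k - 1 : ℤ[X]) = smythTheta := by
  have h : (X ^ (3 * k) - X ^ k - 1 : ℤ[X]) = (X ^ 3 - X - 1 : ℤ[X]).comp (X ^ k) := by
    simp only [sub_comp, pow_comp, X_comp, one_comp]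
    rw [← pow_mul, mul_comm]
  rw [h, intMahlerMeasure_comp_X_pow _ hk, intMahlerMeasure_X_cube_sub_X_sub_one]

/-- `x³ - x - 1` is neither reciprocal nor antireciprocal and has nonzero constant term. -/
theorem X_cube_sub_X_sub_one_nonreciprocal :
    (X ^ 3 - X - 1 : ℤ[X]).coeff 0 ≠ 0 ∧ (X ^ 3 - X - 1 : ℤ[X]).reverse ≠ (X ^ 3 - X - 1) ∧
      (X ^ 3 - X - 1 : ℤ[X]).reverse ≠ -(X ^ 3 - X - 1) := by
  have hdeg : (X ^ 3 - X - 1 : ℤ[X]).natDegree = 3 := by compute_degree!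
  have hc1 : (X ^ 3 - X - 1 : ℤ[X]).reverse.coeff 1 = 0 := by
    rw [coeff_reverse, hdeg, revAt_le (by norm_num)]
    simp [coeff_X, coeff_one]
  have hp1 : (X ^ 3 - X - 1 : ℤ[X]).coeff 1 = -1 := by simp [coeff_X, coeff_one]
  refine ⟨by simp, ?_, ?_⟩
  · intro h
    have h' : (X ^ 3 - X - 1 : ℤ[X]).reverse.coeff 1 = (X ^ 3 - X - 1 : ℤ[X]).coeff 1 := by rw [h]
    rw [hc1, hp1] at h'
    norm_num at h'
  · intro h
    have h' : (X ^ 3 - X - 1 : ℤ[X]).reverse.coeff 1 = (-(X ^ 3 - X - 1 : ℤ[X])).coeff 1 := by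
      rw [h]
    rw [coeff_neg, hc1, hp1] at h'
    norm_num at h'

/-- **Smyth's bound is attained**: there is a nonreciprocal integer polynomial with nonzero
constant term and Mahler measure exactly `θ₀` (namely `x³ - x - 1`). -/
theorem smyth_bound_attained :
    ∃ P : ℤ[X], P.coeff 0 ≠ 0 ∧ P.reverse ≠ P ∧ P.reverse ≠ -P ∧ intMahlerMeasure P = smythTheta :=
  ⟨X ^ 3 - X - 1, X_cube_sub_X_sub_one_nonreciprocal.1, X_cube_sub_X_sub_one_nonreciprocal.2.1,
    X_cube_sub_X_sub_one_nonreciprocal.2.2, intMahlerMeasure_X_cube_sub_X_sub_one⟩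

/-- The infimum form: `θ₀` is the least Mahler measure of a nonreciprocal integer polynomial with
nonzero constant term. -/
theorem isLeast_smythTheta :
    IsLeast {m : ℝ | ∃ P : ℤ[X], P.coeff 0 ≠ 0 ∧ P.reverse ≠ P ∧ P.reverse ≠ -P ∧
      intMahlerMeasure P = m} smythTheta := by
  refine ⟨?_, ?_⟩
  · obtain ⟨P, h0, h1, h2, hM⟩ := smyth_bound_attained
    exact ⟨P, h0, h1, h2, hM⟩
  · rintro m ⟨P, h0, h1, h2, rfl⟩
    exact intMahlerMeasure_ge_smythTheta_of_nonreciprocal h0 h1 h2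

end Summit.Ventures.DiscreteObjects.Mahler
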